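import Summits.CriticalPhenomena.CardyFormulaZ2.Theses.CardySelfRefinement
import Summits.CriticalPhenomena.CardyFormulaZ2.Theorems.CardySelfRefinementLagHandOffLocalityPassage
import Summits.CriticalPhenomena.CardyFormulaZ2.Theorems.CardySelfRefinementLagHandOffChordal
import Literature.Probability.RandomPlanarGeometry.ChordalKSCondition
import HarnessLib

/-!
# Locality passage with the corrected discrete hypotheses: stub `stub_localityPassage2` of line
`crosscut-dictionary` for crux `LagHandOff` (stmt-CriticalPhenomena-10268)

For a Borel reading `Ψ D : ℋ_ℂ → CurveClass ℂ` to which the bond-`ℤ²` interfaces hand off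
jointly (`h1`, `h3`), discretisability of every Dobrushin domain (`h4`), the statement that the
law `(Ψ D)_* μ` depends on `D` only through its carrier and its two marked points (`hcar`), the
CORRECTED discrete locality identity (`hdisc'`: for nested `D' ⊆ D` with the same marked points,
either the ESCAPE disjunct `a ∈ closure (D ∖ D')` holds, or some same-carrier same-marks `D''`
and admissible families `E` of `D`, `E'` of `D''` have interfaces agreeing, at all small meshes
and for every configuration, up to a parameter whose image is `ρ`-close to `closure (D ∖ D')`)
and the discrete splitting identity (`hdiscT`), the family `P D := (Ψ D)_* μ` is LOCAL (LSW
restriction form, `ChordalFamily.IsLocal`) and TARGET INDEPENDENT for every `μ ∈ Λ`.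

Proof (adaptation of the landed `isLocal_of_handsOff` / `isTargetIndependent_of_handsOff` of
`…LagHandOffLocalityPassage`).  Escape disjunct: by `isChordal_of_handsOff` the readings `Ψ D S`
and `Ψ D' S` start at `a = D.pt 0 ∈ F` for `μ`-a.e. `S`, so both stopped classes are the class
of the constant curve at `a` (`CurveClass.stopAt_eq_of_source_mem`), and the two stopped laws
coincide.  Non-escape disjunct: `bondInterfaceIn G Ed ω` depends on `G` only through its marked
points (`bondInterfaceIn_congr_pts`), so the identity is an identity between the interfaces of
`(D'', E')` and `(D, E)`; the landed passage `ae_stopAt_eq_of_handsOff_pair` gives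
`stopAt F (Ψ D'' S) = stopAt F (Ψ D S)` a.e., and `hcar` returns from `(Ψ D'')_* μ` to
`(Ψ D')_* μ`.  Target independence is the landed `isTargetIndependent_of_handsOff` verbatim.

References: G. Lawler, O. Schramm, W. Werner, Acta Math. 187 (2001) §2, Cor. 2.3–2.4;
S. Smirnov, C. R. Acad. Sci. 333 (2001) §2.
-/

noncomputable section

open MeasureTheory Filter Set Topology
open scoped BoundedContinuousFunction
open Literature.Probability.Percolation Literature.Probability.LatticeModels
open Literature.Probability.RandomPlanarGeometry Literature.Probability.Percolation.QuadCrossing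
open Summit.CriticalPhenomena.CardyFormulaZ2.Theses.CardySelfRefinement

namespace Summit.CriticalPhenomena.CardyFormulaZ2.Cruxes.LagHandOff.CrosscutDictionary

/-! ### Two small glue lemmas -/

/-- The lattice interface `bondInterfaceIn D Ed ω` depends on the Dobrushin domain `D` only
through its two marked points (they decide the orientation of G02's exploration polygon). -/
theorem bondInterfaceIn_congr_pts {D₁ D₂ : DobrushinDomain} (h0 : D₁.pt 0 = D₂.pt 0)
    (h1 : D₁.pt 1 = D₂.pt 1) (Ed : DiscreteDobrushin) (ω : BondConfig (Site 2)) :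
    bondInterfaceIn D₁ Ed ω = bondInterfaceIn D₂ Ed ω := by
  simp only [bondInterfaceIn_apply, orientCurve, h0, h1]

/-- If two Borel readings have `μ`-a.e. equal initial segments up to the first hitting of a
closed set `F`, their push-forward laws agree on every event `stopAt F ⁻¹' T`, `T` Borel. -/
theorem map_apply_preimage_stopAt_eq_of_ae {μ : Measure (QuadConfig (Set.univ : Set ℂ))}
    {Ψ₁ Ψ₂ : QuadConfig (Set.univ : Set ℂ) → CurveClass ℂ} (hΨ₁ : Measurable Ψ₁)
    (hΨ₂ : Measurable Ψ₂) {F : Set ℂ} (hF : IsClosed F) {T : Set (CurveClass ℂ)}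
    (hT : MeasurableSet T)
    (hae : ∀ᵐ S ∂μ, CurveClass.stopAt F (Ψ₁ S) = CurveClass.stopAt F (Ψ₂ S)) :
    μ.map Ψ₁ (CurveClass.stopAt F ⁻¹' T) = μ.map Ψ₂ (CurveClass.stopAt F ⁻¹' T) := by
  have hmeas : MeasurableSet (CurveClass.stopAt F ⁻¹' T) := measurableSet_preimage_stopAt hF hT
  rw [Measure.map_apply hΨ₁ hmeas, Measure.map_apply hΨ₂ hmeas]
  refine measure_congr ?_
  filter_upwards [hae] with S hS
  show (S ∈ Ψ₁ ⁻¹' (CurveClass.stopAt F ⁻¹' T)) = (S ∈ Ψ₂ ⁻¹' (CurveClass.stopAt F ⁻¹' T))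
  simp only [Set.mem_preimage, hS]

/-! ### `IsLocal` from the corrected discrete locality identity -/

/-- **`IsLocal` of the hand-off family from the corrected lattice locality identity.**  With the
escape disjunct `a ∈ closure (D ∖ D')` (settled by chordality: both stopped curves are a.s. the
constant curve at `a`) and the freedom to discretise, on the small side, any Dobrushin domain
`D''` with the carrier and the marked points of `D'` (settled by `hcar` and the fact that the
lattice interface only reads the marked points of the domain). -/
theorem isLocal_of_handsOff_of_escape_or_prefix
    (Ψ : DobrushinDomain → QuadConfig (Set.univ : Set ℂ) → CurveClass ℂ)
    (h1 : ∀ D : DobrushinDomain, Measurable (Ψ D))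
    (h3 : ∀ (μ : FiniteMeasure (QuadConfig (Set.univ : Set ℂ))) (δs : ℕ → ℝ), (∀ n, 0 < δs n) →
      Tendsto δs atTop (𝓝 0) →
      Tendsto (fun n => z2QuadLaw (Set.univ : Set ℂ) (δs n)) atTop (𝓝 μ) →
      ∀ (D : DobrushinDomain) (E : ℝ → DiscreteDobrushin), ZdDiscretisationFamily D E →
        ∀ f : (QuadConfig (Set.univ : Set ℂ) × CurveClass ℂ) →ᵇ ℝ,
          Tendsto (fun n => ∫ ω, f (z2QuadConfig (Set.univ : Set ℂ) (δs n) ω,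
              bondInterfaceIn D (E (δs n)) ω) ∂(bondPercolation (zdGraph 2) half))
            atTop (𝓝 (∫ S, f (S, Ψ D S) ∂(μ : Measure (QuadConfig (Set.univ : Set ℂ))))))
    (h4 : ∀ D : DobrushinDomain, ∃ E : ℝ → DiscreteDobrushin, ZdDiscretisationFamily D E)
    (hcar : ∀ μ ∈ subseqQuadLimits (Set.univ : Set ℂ), ∀ D D' : DobrushinDomain,
      D'.carrier = D.carrier → D'.pt 0 = D.pt 0 → D'.pt 1 = D.pt 1 →
        (μ : Measure (QuadConfig (Set.univ : Set ℂ))).map (Ψ D') =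
          (μ : Measure (QuadConfig (Set.univ : Set ℂ))).map (Ψ D))
    (hdisc' : ∀ D D' : DobrushinDomain, D'.carrier ⊆ D.carrier → D'.pt 0 = D.pt 0 →
      D'.pt 1 = D.pt 1 → D.pt 0 ∈ closure (D.carrier \ D'.carrier) ∨
        ∃ (D'' : DobrushinDomain) (E E' : ℝ → DiscreteDobrushin), D''.carrier = D'.carrier ∧
          D''.pt 0 = D'.pt 0 ∧ D''.pt 1 = D'.pt 1 ∧
          ZdDiscretisationFamily D E ∧ ZdDiscretisationFamily D'' E' ∧
          ∀ ρ : ℝ, 0 < ρ → ∀ᶠ δ in 𝓝[>] (0 : ℝ), ∀ ω : BondConfig (Site 2),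
            bondInterfaceIn D' (E' δ) ω = bondInterfaceIn D (E δ) ω ∨
            ∃ (c c' : Curve ℂ) (s : unitInterval),
              CurveClass.mk c = bondInterfaceIn D' (E' δ) ω ∧
              CurveClass.mk c' = bondInterfaceIn D (E δ) ω ∧
              (∀ t : unitInterval, t ≤ s → c t = c' t) ∧
              c s ∈ Metric.cthickening ρ (closure (D.carrier \ D'.carrier)))
    {μ : FiniteMeasure (QuadConfig (Set.univ : Set ℂ))}
    (hμ : μ ∈ subseqQuadLimits (Set.univ : Set ℂ)) :
    ChordalFamily.IsLocal (fun D => (μ : Measure (QuadConfig (Set.univ : Set ℂ))).map (Ψ D)) := by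
  intro D D' hsub h0 h1m T hT
  obtain ⟨δs, hpos, hlim, hconv⟩ := (isSubseqQuadLimit_iff Set.univ μ).1 hμ
  have hF : IsClosed (closure (D.carrier \ D'.carrier)) := isClosed_closure
  show ((μ : Measure (QuadConfig (Set.univ : Set ℂ))).map (Ψ D')) _ =
    ((μ : Measure (QuadConfig (Set.univ : Set ℂ))).map (Ψ D)) _
  rcases hdisc' D D' hsub h0 h1m with ha | ⟨D'', E, E', hcarr, h0'', h1'', hE, hE', hlat⟩
  · -- escape disjunct: both stopped readings are a.s. the constant curve at `a`
    have hch := isChordal_of_handsOff Ψ h1 h3 h4 μ hμ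
    have hsD : ∀ᵐ S ∂(μ : Measure (QuadConfig (Set.univ : Set ℂ))), (Ψ D S).source = D.pt 0 :=
      (ae_of_ae_map (h1 D).aemeasurable (hch D).2).mono fun S h => h.1
    have hsD' : ∀ᵐ S ∂(μ : Measure (QuadConfig (Set.univ : Set ℂ))),
        (Ψ D' S).source = D.pt 0 :=
      (ae_of_ae_map (h1 D').aemeasurable (hch D').2).mono fun S h => h.1.trans h0
    refine map_apply_preimage_stopAt_eq_of_ae (h1 D') (h1 D) hF hT ?_
    filter_upwards [hsD, hsD'] with S hS hS'
    have haD : (Ψ D S).source ∈ closure (D.carrier \ D'.carrier) := by rw [hS]; exact ha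
    have haD' : (Ψ D' S).source ∈ closure (D.carrier \ D'.carrier) := by rw [hS']; exact ha
    rw [CurveClass.stopAt_eq_of_source_mem haD', CurveClass.stopAt_eq_of_source_mem haD, hS, hS']
  · -- non-escape disjunct: run the landed passage for the pair `(D'', E')`, `(D, E)`
    have hpts : ∀ (Ed : DiscreteDobrushin) (ω : BondConfig (Site 2)),
        bondInterfaceIn D'' Ed ω = bondInterfaceIn D' Ed ω :=
      bondInterfaceIn_congr_pts h0'' h1''
    have hlat' : ∀ ρ : ℝ, 0 < ρ → ∀ᶠ δ in 𝓝[>] (0 : ℝ), ∀ ω : BondConfig (Site 2),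
        bondInterfaceIn D'' (E' δ) ω = bondInterfaceIn D (E δ) ω ∨
        ∃ (c c' : Curve ℂ) (s : unitInterval),
          CurveClass.mk c = bondInterfaceIn D'' (E' δ) ω ∧
          CurveClass.mk c' = bondInterfaceIn D (E δ) ω ∧
          (∀ t : unitInterval, t ≤ s → c t = c' t) ∧
          c s ∈ Metric.cthickening ρ (closure (D.carrier \ D'.carrier)) := by
      intro ρ hρ
      filter_upwards [hlat ρ hρ] with δ hδ ω
      rw [hpts]
      exact hδ ω
    have hae := ae_stopAt_eq_of_handsOff_pair hpos hlim hE' hE (h1 D'') (h1 D)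
      (h3 μ δs hpos hlim hconv D'' E' hE') (h3 μ δs hpos hlim hconv D E hE) hF hlat'
    rw [← hcar μ hμ D' D'' hcarr h0'' h1'']
    exact map_apply_preimage_stopAt_eq_of_ae (h1 D'') (h1 D) hF hT hae

/-! ### The registered stub -/

/-- **Registered stub `stub_localityPassage2`.**  For a Borel reading `Ψ` with the joint hand-off
property (`h1`, `h3`), discretisability of every Dobrushin domain (`h4`), dependence of the law
`(Ψ D)_* μ` on `D` only through carrier and marked points (`hcar`), the corrected discrete
locality identity (escape disjunct, or a common-prefix identity for a same-carrier same-marks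
`D''` on the small side) and the discrete splitting identity, the family `P D := (Ψ D)_* μ` is
LOCAL (LSW restriction form) and TARGET INDEPENDENT for every subsequential quad-crossing
limit `μ`. -/
theorem stub_localityPassage2 : ∀ Ψ : DobrushinDomain → QuadConfig (Set.univ : Set ℂ) → CurveClass ℂ, (∀ D : DobrushinDomain, Measurable (Ψ D)) → (∀ (μ : FiniteMeasure (QuadConfig (Set.univ : Set ℂ))) (δs : ℕ → ℝ), (∀ n, 0 < δs n) → Tendsto δs atTop (𝓝 0) → Tendsto (fun n => z2QuadLaw (Set.univ : Set ℂ) (δs n)) atTop (𝓝 μ) → ∀ (D : DobrushinDomain) (E : ℝ → DiscreteDobrushin), ZdDiscretisationFamily D E → ∀ f : (QuadConfig (Set.univ : Set ℂ) × CurveClass ℂ) →ᵇ ℝ, Tendsto (fun n => ∫ ω, f (z2QuadConfig (Set.univ : Set ℂ) (δs n) ω, bondInterfaceIn D (E (δs n)) ω) ∂(bondPercolation (zdGraph 2) half)) atTop (𝓝 (∫ S, f (S, Ψ D S) ∂(μ : Measure (QuadConfig (Set.univ : Set ℂ)))))) → (∀ D : DobrushinDomain, ∃ E : ℝ → DiscreteDobrushin,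 ZdDiscretisationFamily D E) → (∀ μ ∈ subseqQuadLimits (Set.univ : Set ℂ), ∀ D D' : DobrushinDomain, D'.carrier = D.carrier → D'.pt 0 = D.pt 0 → D'.pt 1 = D.pt 1 → (μ : Measure (QuadConfig (Set.univ : Set ℂ))).map (Ψ D') = (μ : Measure (QuadConfig (Set.univ : Set ℂ))).map (Ψ D)) → (∀ D D' : DobrushinDomain, D'.carrier ⊆ D.carrier → D'.pt 0 = D.pt 0 → D'.pt 1 = D.pt 1 → D.pt 0 ∈ closure (D.carrier \ D'.carrier) ∨ ∃ (D'' : DobrushinDomain) (E E' : ℝ → DiscreteDobrushin), D''.carrier = D'.carrier ∧ D''.pt 0 = D'.pt 0 ∧ D''.pt 1 = D'.pt 1 ∧ ZdDiscretisationFamily D E ∧ ZdDiscretisationFamily D'' E' ∧ ∀ ρ : ℝ, 0 < ρ → ∀ᶠ δ in nhdsWithin (0 : ℝ) (Set.Ioi 0), ∀ ω : BondConfig (Site 2), bondInterfaceIn D' (E' δ) ω = bondInterfaceIn D (E δ) ω ∨ ∃ (c c' : Curve ℂ) (s : unitInterval), CurveClass.mk c = bondInterfaceIn D' (E' δ) ω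 ∧ CurveClass.mk c' = bondInterfaceIn D (E δ) ω ∧ (∀ t : unitInterval, t ≤ s → c t = c' t) ∧ c s ∈ Metric.cthickening ρ (closure (D.carrier \ D'.carrier))) → (∀ D : MarkedDomain 3, ∃ E₁ E₂ : ℝ → DiscreteDobrushin, ZdDiscretisationFamily (D.chord 0 1 (by decide)) E₁ ∧ ZdDiscretisationFamily (D.chord 0 2 (by decide)) E₂ ∧ ∀ ρ : ℝ, 0 < ρ → ∀ᶠ δ in nhdsWithin (0 : ℝ) (Set.Ioi 0), ∀ ω : BondConfig (Site 2), bondInterfaceIn (D.chord 0 1 (by decide)) (E₁ δ) ω = bondInterfaceIn (D.chord 0 2 (by decide)) (E₂ δ) ω ∨ ∃ (c c' : Curve ℂ) (s : unitInterval), CurveClass.mk c = bondInterfaceIn (D.chord 0 1 (by decide)) (E₁ δ) ω ∧ CurveClass.mk c' = bondInterfaceIn (D.chord 0 2 (by decide)) (E₂ δ) ω ∧ (∀ t : unitInterval, t ≤ s → c t = c' t) ∧ c s ∈ Metric.cthickening ρ (D.arc 1)) → ∀ μ ∈ subseqQuadLimits (Set.univ : Set ℂ), ChordalFamily.IsLocal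 (fun D => (μ : Measure (QuadConfig (Set.univ : Set ℂ))).map (Ψ D)) ∧ ChordalFamily.IsTargetIndependent (fun D => (μ : Measure (QuadConfig (Set.univ : Set ℂ))).map (Ψ D)) :=
  fun Ψ h1 h3 h4 hcar hdisc' hdiscT _ hμ =>
    ⟨isLocal_of_handsOff_of_escape_or_prefix Ψ h1 h3 h4 hcar hdisc' hμ,
      isTargetIndependent_of_handsOff Ψ h1 h3 hdiscT hμ⟩

end Summit.CriticalPhenomena.CardyFormulaZ2.Cruxes.LagHandOff.CrosscutDictionary

end
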